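import Literature.Geometry.Symplectic.LefschetzBaseModelStein
import Literature.Topology.FourManifolds.LefschetzBaseModelOrientation
import HarnessLib

/-!
# The Stein model of the Lefschetz base, with its orientation-preserving identification

Topic `Literature/Geometry/Symplectic`; a proofs-only supplement (no definition, no named fact)
of `LefschetzBaseModelStein.lean`: `exists_steinStructure_model` recombined with
`exists_model_diffeomorph_orient` (`LefschetzBaseModelOrientation.lean`), so that the
page-preserving diffeomorphism `Φ` of `ℂ²` over which `Base g ≅ {Ψ ≤ 1/4}` also has
`det DΦ > 0` everywhere — the form consumed by the orientation clause of
`palf_stein_supportedByBoundaryOpenBook_of_reebModels` (positive boundary frames of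
`∂ Base g ⊂ ℂ²` go to frames positive for the complex orientation of the model).

## References

* S. Akbulut, B. Ozbagci, *Lefschetz fibrations on compact Stein surfaces*, Geom. Topol. 5 (2001),
  proof of Thm. 5. [AkbulutOzbagci2001]
* J. Milnor, *Topology from the Differentiable Viewpoint* (1965), §6. [MilnorTDV1965]
-/

noncomputable section

open scoped Manifold ContDiff Topology
open Set Function

namespace Literature.Geometry.Symplectic

open Literature.Topology.FourManifolds Literature.Topology.FourManifolds.LefschetzBase

/-- **The rounded convex model of the base is a Stein domain, identified with `Base g` over an
orientation-preserving page-preserving diffeomorphism of `ℂ²`.**  As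
`exists_steinStructure_model`, with the additional clause `∀ z, 0 < det DΦ(z)`.
[cite: AkbulutOzbagci2001, Thm. 5] -/
theorem exists_steinStructure_model_orient (g : ℕ) :
    ∃ δ : ℝ, 0 < δ ∧ ∃ ε : ℝ, 0 < ε ∧
      ∃ (hΨ : IsRegularLevel (𝓡 4) (modelFun g ε (qPert δ)) (1 / 4))
        (_ : CompactSpace (RegularSublevel hΨ))
        (Φ : EuclideanSpace ℝ (Fin 4) ≃ₘ⟮𝓘(ℝ, EuclideanSpace ℝ (Fin 4)),
          𝓘(ℝ, EuclideanSpace ℝ (Fin 4))⟯ EuclideanSpace ℝ (Fin 4))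
        (e : Base g ≃ₘ⟮𝓡∂ 4, 𝓡∂ 4⟯ RegularSublevel hΨ)
        (S : SteinStructure (RegularSublevel hΨ)),
        (∀ p, RegularSublevel.incl hΨ (e p) = Φ (RegularSublevel.incl (isRegularLevel_rho g) p)) ∧
        Φ '' (rho g ⁻¹' Iic (1 / 4)) = modelFun g ε (qPert δ) ⁻¹' Iic (1 / 4) ∧
        Φ '' (rho g ⁻¹' {1 / 4}) = modelFun g ε (qPert δ) ⁻¹' {1 / 4} ∧
        (∀ z, ∃ r : ℝ, 0 < r ∧ w g (Φ z) = (r : ℂ) * w g z) ∧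
        (∀ z, 0 < LinearMap.det (fderiv ℝ Φ z :
          EuclideanSpace ℝ (Fin 4) →ₗ[ℝ] EuclideanSpace ℝ (Fin 4))) ∧
        (∀ z, rho g z ≤ 1 / 4 → ∀ u : EuclideanSpace ℝ (Fin 4), u ≠ 0 →
          0 < fderiv ℝ (fderiv ℝ (modelFun g ε (qPert δ))) z u u +
            fderiv ℝ (fderiv ℝ (modelFun g ε (qPert δ))) z (stdComplexStructure u)
              (stdComplexStructure u)) ∧
        S.φ = sublevelPhi hΨ ∧ S.J = sublevelJ hΨ stdComplexStructure := by
  obtain ⟨δ₀, hδ₀, Hpsh⟩ := exists_levi_modelFun_pos g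
  obtain ⟨ε₀, hε₀, Hid⟩ :=
    exists_model_diffeomorph_orient g (contDiff_qPert δ₀) (qPert_nonneg hδ₀.le)
  set ε := min ε₀ 1 with hεdef
  have hε : 0 < ε := lt_min hε₀ one_pos
  obtain ⟨hΨ, Φ, e, he, hle, heq, hw, hdet⟩ := Hid ε hε.le (min_le_left _ _)
  have hpsh := Hpsh δ₀ hδ₀ le_rfl ε hε (min_le_right _ _)
  haveI : CompactSpace (RegularSublevel hΨ) := isCompact_iff_compactSpace.1
    (isCompact_modelFun_le g hε.le (contDiff_qPert δ₀) (qPert_nonneg hδ₀.le))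
  obtain ⟨S, hSφ, hSJ⟩ := exists_steinStructure_sublevel_of_levi_pos hΨ stdComplexStructure
    stdComplexStructure_sq (exists_modelFun_qPert_eq g ε δ₀)
    (fun z hz u hu => hpsh z ((rho_le_modelFun g hε.le (qPert_nonneg hδ₀.le) z).trans hz) u hu)
  exact ⟨δ₀, hδ₀, ε, hε, hΨ, inferInstance, Φ, e, S, he, hle, heq, hw, hdet, hpsh, hSφ, hSJ⟩

end Literature.Geometry.Symplectic

end
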